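import Literature.NumberTheory.Automorphic.BrandtEichlerLevelUOperators
import Literature.NumberTheory.Automorphic.EichlerOrderAtkinLehnerIdeal
import Literature.NumberTheory.Automorphic.BrandtSetupAdmissible
import Literature.NumberTheory.Automorphic.BrandtModuleDictionary
import Literature.NumberTheory.Automorphic.EichlerSubidealCount
import Summits.BirchSwinnertonDyer.BirchSwinnertonDyer.Theorems.RamifiedHeegnerPairLeafPartnerOrdersUHermiteLocal
import HarnessLib

/-!
# Route `RamifiedHeegnerPair`, crux U₁ `LeafRankOneUpperAtThree` (stmt-BirchSwinnertonDyer-26022), line `partnerdescent` —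
# the Hecke–Atkin–Lehner twist (HT) from the tree, part 2: the ORIENTED level model of a Brandt setup at a level prime, and the
# link `𝒯 = link(O₁, O₂)` in that model

HONEST FRAMING. Theorems only; helper file (`--supports stmt-BirchSwinnertonDyer-26022`); local algebra over the tree's Brandt layer
(‹BrandtEichlerLevelUOperators›: the chosen orientation `S.O₁, S.O₂` of a setup and `Brandt.link`; ‹EichlerOrderLocalConjugacy›
`exists_conjUnit_localAt_inf_iff_eichler`; ‹EichlerOrderAtkinLehnerIdeal› `AtkinLehner.IsLevelShape`); no named fact, no `sorry`;
nothing booked; BSD is proved for no curve. Lead prover bsd-line-rhp-p2 g65, 2026-08-31.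

WHAT. For a Brandt setup `S` of type `(N⁺, N⁻)` and a prime `ℓ ∤ N⁻` with `e = v_ℓ(N⁺)`:
* `exists_orientedLevelModel` — a `ℚ`-algebra map `Φ : D → M₂(ℚ_ℓ)` with BOTH `S.O₁,₍ℓ₎ = Φ⁻¹(M₂(ℤ_ℓ))` and
  `S.O₍ℓ₎ = Φ⁻¹(ℤ_ℓ ℤ_ℓ; ℓ^e ℤ_ℓ ℤ_ℓ)` (the tree's `XiSetup.exists_isLevelShape_iff` forgets the first maximal order; here the
  normal form of the PAIR `(S.O₁, S.O₂)` is kept, Vignéras II §2 Thm. 2.3 / Lemme 2.4);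
* `mem_localAt_link_iff` — `x ∈ link(O₁, O₂)₍ℓ₎ ↔ x ∈ O₁,₍ℓ₎ ∧ ∀ y ∈ O₁, x y ∈ O₍ℓ₎` (finite generation of `O₁`);
* `mem_localAt_link_iff_shape` — in the model: `x ∈ link(O₁, O₂)₍ℓ₎ ↔ Φ x ∈ (ℤ_ℓ ℤ_ℓ; ℓ^e ℤ_ℓ ℓ^e ℤ_ℓ)` — the local
  connecting ideal `Hom(L₁, L₂)` of the module docstring of ‹BrandtEichlerLevelUOperators› («locally `𝒯_ℓ = Hom(L₁, L₂)`»);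
* `mem_smul_localAt_O₁_iff_shape` — `x ∈ ℓ · O₁,₍ℓ₎ ↔ ‖Φ x i j‖ ≤ ℓ⁻¹`.
[cite: VignerasLNM800, Ch. II §2 Thm. 2.3, Lemme 2.4; Ch. III §5 Prop. 5.1] [cite: BertoliniDarmon2001, §3.1 p. 127]
-/

set_option linter.dupNamespace false
set_option autoImplicit false

noncomputable section

namespace Summit.BirchSwinnertonDyer.BirchSwinnertonDyer.Theorems.LeafPartnerOrders

open scoped Pointwise
open Literature.NumberTheory.Automorphic Literature.NumberTheory.Automorphic.Brandt
  Literature.NumberTheory.Automorphic.AtkinLehner NumberField IsDedekindDomain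

variable {Nplus Nminus : ℕ} (S : XiSetup Nplus Nminus)

/-- The algebra of a setup is a division algebra. [folklore] -/
private theorem hdivD_g65 : ∀ x : S.D, x ≠ 0 → IsUnit x :=
  fun _ hx ↦ isUnit_of_isTotallyDefinite S.D S.isTotallyDefinite hx

/-- The Eichler order of a setup is a `ℤ`-order. [folklore] -/
theorem isZOrder_g65 : IsZOrder S.O := isZOrder_iff_isOrder.mpr S.isEichlerOrder.isOrder

/-- The first maximal order of the chosen orientation is a `ℤ`-order. [folklore] -/
theorem isZOrder_O₁_g65 : IsZOrder S.O₁ := isZOrder_iff_isOrder.mpr S.isOrder_O₁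

/-! ### The oriented level model -/

/-- **The oriented level model of a Brandt setup at a prime `ℓ ∤ N⁻`.** There is a `ℚ`-algebra map `Φ : D → M₂(ℚ_ℓ)` with
`S.O₁,₍ℓ₎ = Φ⁻¹(M₂(ℤ_ℓ))` AND `S.O₍ℓ₎ = Φ⁻¹(ℤ_ℓ ℤ_ℓ; ℓ^e ℤ_ℓ ℤ_ℓ)`, `e = v_ℓ(N⁺)`: the normal form of the pair of maximal orders
`(S.O₁, S.O₂)` at the split prime `ℓ` (‹EichlerOrderLocalConjugacy› `exists_conjUnit_localAt_inf_iff_eichler`), the exponent read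
off from `[S.O₁ : S.O] = N⁺` (`relIndex_eq_pow_of_eichler`, `relIndex_localAt`). [cite: VignerasLNM800, Ch. II §2 Thm. 2.3 (1), Lemme 2.4; Ch. III §5 Prop. 5.1] -/
theorem exists_orientedLevelModel {ℓ : ℕ} [hℓ : Fact ℓ.Prime] (hℓm : ¬ ℓ ∣ Nminus) :
    ∃ Φ : S.D →ₐ[ℚ] Matrix (Fin 2) (Fin 2) ℚ_[ℓ],
      (∀ x : S.D, x ∈ localAt ℓ S.O₁ ↔ ∀ i j, ‖Φ x i j‖ ≤ 1) ∧
      (∀ x : S.D, x ∈ localAt ℓ S.O ↔ IsLevelShape (Nplus.factorization ℓ) (Φ x)) := by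
  have hram : ∀ v : HeightOneSpectrum (𝓞 ℚ), v ∈ ramifiedPlaces ℚ S.D ↔ ((Nminus : ℕ) : 𝓞 ℚ) ∈ v.asIdeal :=
    S.toEichlerPackage.mem_ramifiedPlaces_iff
  obtain ⟨φ⟩ := exists_algHom_matrix_of_not_dvd (B := S.D) hram hℓm
  have h₁ : IsMaximalZOrder S.O₁ := isMaximalZOrder_iff_isMaximalOrder.mpr S.isMaximalOrder_O₁
  have h₂ : IsMaximalZOrder S.O₂ := isMaximalZOrder_iff_isMaximalOrder.mpr S.isMaximalOrder_O₂
  obtain ⟨u, d, hu₁, hu⟩ := exists_conjUnit_localAt_inf_iff_eichler (hdivD_g65 S) h₁ h₂ φ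
  rw [← S.O_eq_inf] at hu
  have hind := relIndex_eq_pow_of_eichler (AlgHom.conjUnit φ u) hu₁ hu
  have hn0 : S.O.toAddSubgroup.relIndex S.O₁.toAddSubgroup ≠ 0 := by rw [S.relIndex_O_O₁]; exact S.nplus_ne_zero
  rw [relIndex_localAt S.O₁ S.O S.O_le_O₁ hn0, S.relIndex_O_O₁] at hind
  have hd : Nplus.factorization ℓ = d := Nat.pow_right_injective hℓ.out.two_le hind
  exact ⟨AlgHom.conjUnit φ u, hu₁, fun x ↦ by rw [hd]; exact hu x⟩

/-! ### The link `𝒯 = link(O₁, O₂)` localised -/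

/-- `link(O₁, O₂) = {x ∈ O₁ : x O₁ ⊆ O}` for `O = O₁ ∩ O₂` (since `x O₁ ⊆ O₁` automatically). [folklore] -/
theorem mem_link_iff_O (x : S.D) : x ∈ link S.O₁ S.O₂ ↔ x ∈ S.O₁ ∧ ∀ y ∈ S.O₁, x * y ∈ S.O := by
  rw [mem_link_iff]
  refine and_congr_right fun hx ↦ forall₂_congr fun y hy ↦ ?_
  rw [S.O_eq_inf, Submodule.mem_inf]
  exact ⟨fun h ↦ ⟨S.isOrder_O₁.mul_mem x hx y hy, h⟩, fun h ↦ h.2⟩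

/-- **The localised link**: `x ∈ link(O₁, O₂)₍ℓ₎ ↔ x ∈ O₁,₍ℓ₎ ∧ ∀ y ∈ O₁, x y ∈ O₍ℓ₎` (for `⇐`: `O₁` is finitely generated, so one
integer prime to `ℓ` clears all the denominators at once). [folklore] -/
theorem mem_localAt_link_iff (ℓ : ℕ) (x : S.D) :
    x ∈ localAt ℓ (link S.O₁ S.O₂) ↔ x ∈ localAt ℓ S.O₁ ∧ ∀ y ∈ S.O₁, x * y ∈ localAt ℓ S.O := by
  constructor
  · rintro ⟨c, hc0, hc, hcx⟩
    rw [mem_link_iff_O S] at hcx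
    exact ⟨⟨c, hc0, hc, hcx.1⟩, fun y hy ↦ ⟨c, hc0, hc, by rw [← smul_mul_assoc]; exact hcx.2 y hy⟩⟩
  · rintro ⟨⟨c, hc0, hc, hcx⟩, hxy⟩
    classical
    obtain ⟨s, hs⟩ := S.isOrder_O₁.isFullLattice.1
    -- one denominator per generator
    have hgen : ∀ y : S.D, ∃ m : ℕ, m ≠ 0 ∧ m.Coprime ℓ ∧ (y ∈ (s : Set S.D) → (m : ℤ) • (x * y) ∈ S.O) := fun y ↦ by
      by_cases hy : y ∈ (s : Set S.D)
      · obtain ⟨m, hm0, hm, hmy⟩ := hxy y (hs ▸ Submodule.subset_span hy)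
        exact ⟨m, hm0, hm, fun _ ↦ hmy⟩
      · exact ⟨1, one_ne_zero, Nat.coprime_one_left ℓ, fun h ↦ (hy h).elim⟩
    choose m hm0 hm hmy using hgen
    set M : ℕ := c * ∏ y ∈ s, m y with hM
    have hM0 : M ≠ 0 := mul_ne_zero hc0 (Finset.prod_ne_zero_iff.mpr fun y _ ↦ hm0 y)
    have hMc : M.Coprime ℓ := Nat.Coprime.mul_left hc (Nat.Coprime.prod_left fun y _ ↦ hm y)
    refine ⟨M, hM0, hMc, ?_⟩
    rw [mem_link_iff_O S]
    refine ⟨?_, fun y hy ↦ ?_⟩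
    · rw [hM, Nat.cast_mul, mul_comm, mul_smul]
      exact S.O₁.smul_mem _ hcx
    · -- `M (x y) ∈ O` for every `y ∈ O₁ = span s`
      rw [← hs] at hy
      refine Submodule.span_induction (p := fun y _ ↦ ((M : ℤ) • x) * y ∈ S.O) ?_ ?_ ?_ ?_ hy
      · intro y hys
        obtain ⟨k, hk⟩ : m y ∣ M := by
          rw [hM]
          exact Dvd.dvd.mul_left (Finset.dvd_prod_of_mem m hys) c
        rw [smul_mul_assoc, hk, Nat.cast_mul, mul_comm, mul_smul]
        exact S.O.smul_mem _ (hmy y hys)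
      · rw [mul_zero]; exact S.O.zero_mem
      · intro a b _ _ ha hb
        rw [mul_add]; exact S.O.add_mem ha hb
      · intro n a _ ha
        rw [mul_smul_comm]; exact S.O.smul_mem n ha

section Model

variable {S}
variable {ℓ : ℕ} [hℓ : Fact ℓ.Prime] {e : ℕ} (Φ : S.D →ₐ[ℚ] Matrix (Fin 2) (Fin 2) ℚ_[ℓ])
  (hΦ₁ : ∀ x : S.D, x ∈ localAt ℓ S.O₁ ↔ ∀ i j, ‖Φ x i j‖ ≤ 1)
  (hΦ : ∀ x : S.D, x ∈ localAt ℓ S.O ↔ IsLevelShape e (Φ x))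

/-- `0 < ℓ^{-e}`. [folklore] -/
private theorem zpow_neg_pos_g65 (e : ℕ) : 0 < (ℓ : ℝ) ^ (-(e : ℤ)) := zpow_pos (by exact_mod_cast hℓ.out.pos) _

omit hℓ in
/-- The `(1,0)` entry of a product of `2 × 2` matrices. [folklore] -/
theorem mul_apply_one_zero [Fact ℓ.Prime] (X Y : Matrix (Fin 2) (Fin 2) ℚ_[ℓ]) : (X * Y) 1 0 = X 1 0 * Y 0 0 + X 1 1 * Y 1 0 := by
  rw [Matrix.mul_apply, Fin.sum_univ_two]

include hΦ₁ in
/-- **Entry test.** If `Φ x` is integral and `‖(Φ x · Φ y)₁₀‖ ≤ ℓ^{-e}` for every `y ∈ O₁,₍ℓ₎`, then `‖(Φ x)₁₀‖, ‖(Φ x)₁₁‖ ≤ ℓ^{-e}`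
— test against `y` with `Φ y ≡ E₀₀`, resp. `E₁₀`, modulo `ℓ^e` (density of `Φ(D)`; such `y` are integral, hence in `O₁,₍ℓ₎`). [folklore] -/
theorem norm_apply_le_of_entry_test {x : S.D} (hint : ∀ i j, ‖Φ x i j‖ ≤ 1)
    (htest : ∀ y ∈ localAt ℓ S.O₁, ‖(Φ x * Φ y) 1 0‖ ≤ (ℓ : ℝ) ^ (-(e : ℤ))) (k : Fin 2) :
    ‖Φ x 1 k‖ ≤ (ℓ : ℝ) ^ (-(e : ℤ)) := by
  set r := (ℓ : ℝ) ^ (-(e : ℤ))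
  have hr1 := zpow_neg_le_one' (ℓ := ℓ) e
  obtain ⟨y, hy⟩ := AlgHom.exists_norm_sub_le Φ (Matrix.single k 0 (1 : ℚ_[ℓ])) e
  set Δ := Φ y - Matrix.single k 0 (1 : ℚ_[ℓ]) with hΔ
  have hΦy : Φ y = Matrix.single k 0 (1 : ℚ_[ℓ]) + Δ := by rw [hΔ]; abel
  have hyO : y ∈ localAt ℓ S.O₁ := by
    rw [hΦ₁]
    intro i j
    rw [hΦy, Matrix.add_apply]
    refine (IsUltrametricDist.norm_add_le_max _ _).trans (max_le ?_ ((hy i j).trans hr1))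
    rw [Matrix.single_apply]
    split_ifs <;> simp
  have hk : k = 0 ∨ k = 1 := by
    rcases Fin.exists_fin_two.mp ⟨k, rfl⟩ with h | h
    · exact Or.inl h
    · exact Or.inr h
  have key : (Φ x * Φ y) 1 0 = Φ x 1 k + (Φ x 1 0 * Δ 0 0 + Φ x 1 1 * Δ 1 0) := by
    rw [mul_apply_one_zero, hΦy, Matrix.add_apply, Matrix.add_apply, Matrix.single_apply, Matrix.single_apply]
    rcases hk with rfl | rfl <;> simp <;> ring
  -- `(Φ x Φ y)₁₀ = (Φ x)_{1k} + error`, error of norm `≤ r`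
  have herr : ‖Φ x 1 0 * Δ 0 0 + Φ x 1 1 * Δ 1 0‖ ≤ r :=
    norm_add_mul_le' ((mul_le_mul (hint 1 0) (hy 0 0) (norm_nonneg _) zero_le_one).trans (one_mul r).le)
      ((mul_le_mul (hint 1 1) (hy 1 0) (norm_nonneg _) zero_le_one).trans (one_mul r).le)
  have e1 : Φ x 1 k = (Φ x * Φ y) 1 0 - (Φ x 1 0 * Δ 0 0 + Φ x 1 1 * Δ 1 0) := by rw [key]; ring
  rw [e1, sub_eq_add_neg]
  exact (IsUltrametricDist.norm_add_le_max _ _).trans (max_le (htest y hyO) (by rw [norm_neg]; exact herr))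

include hΦ₁ hΦ in
/-- **The link in the oriented level model**: `x ∈ link(O₁, O₂)₍ℓ₎ ↔ Φ x ∈ (ℤ_ℓ ℤ_ℓ; ℓ^e ℤ_ℓ ℓ^e ℤ_ℓ)` — integral with the whole second
row in `ℓ^e ℤ_ℓ` — i.e. locally `𝒯 = Hom(L₁, L₂)` for `O₁ = End(L₁)`, `O₂ = End(L₂)`, `L₁ ⊋ L₂ ⊋ ℓ^e L₁`. [cite: VignerasLNM800, Ch. III §5 (idéal qui lie deux ordres)] -/
theorem mem_localAt_link_iff_shape (x : S.D) :
    x ∈ localAt ℓ (link S.O₁ S.O₂) ↔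
      (∀ i j, ‖Φ x i j‖ ≤ 1) ∧ ‖Φ x 1 0‖ ≤ (ℓ : ℝ) ^ (-(e : ℤ)) ∧ ‖Φ x 1 1‖ ≤ (ℓ : ℝ) ^ (-(e : ℤ)) := by
  set r := (ℓ : ℝ) ^ (-(e : ℤ))
  rw [mem_localAt_link_iff S]
  constructor
  · rintro ⟨hx1, hxy⟩
    have hint : ∀ i j, ‖Φ x i j‖ ≤ 1 := (hΦ₁ x).mp hx1
    -- `x y ∈ O₍ℓ₎` for every `y ∈ O₁,₍ℓ₎` (clear the denominator of `y`)
    have htest : ∀ y ∈ localAt ℓ S.O₁, ‖(Φ x * Φ y) 1 0‖ ≤ r := by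
      rintro y ⟨c, hc0, hc, hcy⟩
      have h := hxy _ hcy
      rw [mul_smul_comm] at h
      have h' : x * y ∈ localAt ℓ S.O := by
        obtain ⟨c', hc0', hc', h''⟩ := h
        exact ⟨c' * c, mul_ne_zero hc0' hc0, hc'.mul_left hc, by rw [Nat.cast_mul, mul_smul]; exact h''⟩
      have hshape := (hΦ _).mp h'
      rw [map_mul] at hshape
      exact hshape.2
    exact ⟨hint, norm_apply_le_of_entry_test Φ hΦ₁ hint htest 0, norm_apply_le_of_entry_test Φ hΦ₁ hint htest 1⟩
  · rintro ⟨hint, h10, h11⟩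
    refine ⟨(hΦ₁ x).mpr hint, fun y hy ↦ ?_⟩
    have hyint : ∀ i j, ‖Φ y i j‖ ≤ 1 := (hΦ₁ y).mp (le_localAt ℓ _ hy)
    rw [hΦ, map_mul]
    refine ⟨fun i j ↦ Padic.norm_mul_apply_le_one hint hyint i j, ?_⟩
    rw [mul_apply_one_zero]
    exact norm_add_mul_le' ((mul_le_mul h10 (hyint 0 0) (norm_nonneg _) (zpow_neg_pos_g65 e).le).trans (mul_one r).le)
      ((mul_le_mul h11 (hyint 1 0) (norm_nonneg _) (zpow_neg_pos_g65 e).le).trans (mul_one r).le)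

include hΦ₁ in
/-- **`x ∈ ℓ · O₁,₍ℓ₎ ↔ ‖Φ x i j‖ ≤ ℓ⁻¹` for all `i, j`** (`Φ(ℓ⁻¹ x) = ℓ⁻¹ Φ x` is integral). [folklore] -/
theorem mem_smul_localAt_O₁_iff_shape (x : S.D) :
    x ∈ ((ℓ : ℕ) : ℤ) • localAt ℓ S.O₁ ↔ ∀ i j, ‖Φ x i j‖ ≤ (ℓ : ℝ)⁻¹ := by
  have hℓ0 : (ℓ : ℚ) ≠ 0 := by exact_mod_cast hℓ.out.ne_zero
  have hℓQ : ‖(ℓ : ℚ_[ℓ])‖ = (ℓ : ℝ)⁻¹ := Padic.norm_p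
  have hΦs : ∀ y : S.D, Φ ((ℓ : ℚ)⁻¹ • y) = (ℓ : ℚ_[ℓ])⁻¹ • Φ y := fun y ↦ by
    rw [map_smul, ← map_natCast (algebraMap ℚ ℚ_[ℓ]), ← map_inv₀, algebraMap_smul]
  constructor
  · intro hx i j
    obtain ⟨y, hy, rfl⟩ := (Submodule.mem_smul_pointwise_iff_exists x _ _).mp hx
    have hyint := (hΦ₁ y).mp hy i j
    rw [map_zsmul, Matrix.smul_apply, ← Int.cast_smul_eq_zsmul ℚ_[ℓ], smul_eq_mul, norm_mul, Int.cast_natCast, hℓQ]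
    exact (mul_le_mul_of_nonneg_left hyint (inv_nonneg.mpr (Nat.cast_nonneg ℓ))).trans (mul_one _).le
  · intro h
    have hy : (ℓ : ℚ)⁻¹ • x ∈ localAt ℓ S.O₁ := by
      rw [hΦ₁]
      intro i j
      rw [hΦs, Matrix.smul_apply, smul_eq_mul, norm_mul, norm_inv, hℓQ, inv_inv]
      calc (ℓ : ℝ) * ‖Φ x i j‖ ≤ ℓ * (ℓ : ℝ)⁻¹ := by gcongr; exact h i j
        _ = 1 := mul_inv_cancel₀ (by exact_mod_cast hℓ.out.ne_zero)
    have e1 : x = ((ℓ : ℕ) : ℤ) • ((ℓ : ℚ)⁻¹ • x) := by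
      rw [natCast_zsmul_eq_ratCast_smul, smul_smul, mul_inv_cancel₀ hℓ0, one_smul]
    rw [e1]
    exact Submodule.smul_mem_pointwise_smul _ _ _ hy

end Model

end Summit.BirchSwinnertonDyer.BirchSwinnertonDyer.Theorems.LeafPartnerOrders

end
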